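import Literature.NumberTheory.Automorphic.UnitaryTwoPlaceWindowFamilyContinuous   -- ★ p844173 (this seat): window families continuous from the `L_w`-matrix; descent forms; entrywise criteria
import Literature.NumberTheory.Automorphic.AdeleGaloisDescent                        -- ★ `isClosedEmbedding_adicCompletionOfLiesOver` (`F_v → E_w` is a closed embedding)
import HarnessLib

/-!
# Continuity of the Eisenstein TORUS COORDINATES read off the descent matrix `G_t = diag(1,α)·↑(E₂ t)·diag(1,α)⁻¹ = s_t • ι_w(regRep 1 b_t)`
# (road «R1LL-WILD» (Ψ3), FILE 2e: the coordinate half of the `hN`∕`hND` sockets of ★ `wildWindow_eventually_eq`)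

Topic `NumberTheory/Automorphic`; namespace `Literature.NumberTheory.Automorphic.UnitaryGroup`.  THEOREMS ONLY (no definition, no instance, no notation, no named
fact, no `sorry`).  Cell `pub/hodgecm-mathlib` (D-0151), crux H413 = `stmt-HodgeConjecture-24833`; architect A-p16 (g28) A-37∕A-44∕A-45 (standard position `hpos`:
`diag(1,α) * ↑(E₂ t₀.1) * diag(1,α⁻¹) = s • (!![a, b·v₀; b, a + b·u₀]).map ι_w`), (W′-B6) F0P3-p01 (g14) sub-socket map («B-p04 proves `ContinuousAt (N i) s`»), (B6-V)-ρ dress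
B-p14 (g33) (normal form `N i t := (E₂.symm (d′ (s_t • ι(M_i t)) d), (↑t).2)`, after B-p08 (g28) 12:03:55Z).

THE POINT.  The descent of a torus element `t` in standard position is `G_t = s_t • ι_w(!![a_t, b_t v₀; b_t, a_t + b_t u₀])`, unique only up to `(s, a, b) ∼ (s c⁻¹, c a, c b)`
(`c ∈ L⁺_vˣ`).  NEAR A SINGULAR POINT (and on the whole deep locus) `a_t ≠ 0`, so the normalisation `a_t = 1` is available and makes the coordinates FUNCTIONS of the matrix:
`s_t = (G_t)₀₀`, `ι_w(b_t) = (G_t)₁₀ ∕ (G_t)₀₀`.  Both are CONTINUOUS AT every point where `(G_t)₀₀ ≠ 0`: `G` is continuous (`E₂` is a homeomorphism, conjugation by a fixed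
matrix is continuous), a quotient of continuous entries is continuous off the zeros of the denominator (`L_w` is a topological field), and `b_t` itself is continuous because
`ι_w : L⁺_v → L_w` is a CLOSED EMBEDDING (★ `isClosedEmbedding_adicCompletionOfLiesOver`).  With ★ p844173 (`continuousAt_descentForm_of_continuousAt`,
`continuousAt_matrix_two_of_entries`, `continuousAt_windowFamily_centralizer_of_coe`) this closes `hN`∕`hND` for any window normal form whose small matrix `M_i t` is a
polynomial in `b_t` with constant coefficients (§3).

* §1 `isClosedEmbedding_toPlace`, `continuousAt_iff_toPlace_comp`, `continuous_iff_toPlace_comp`, **`continuousAt_of_toPlace_comp_eventuallyEq`** (a coordinate `b` is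
  continuous at `x₀` as soon as `ι_w ∘ b` agrees near `x₀` with a function continuous at `x₀`).
* §2 `continuousAt_matrix_apply` (entries), `continuousAt_matrix_apply_div` (ratio of two entries off the zeros of the denominator), `continuous_conj_coe_placeModel`
  (`t ↦ d * ↑(E₂ (↑t).1) * d′` on `Z(t₀)`), **`continuousAt_eisensteinCoords`** (for `G` continuous at `x₀` with `G x₀ 0 0 ≠ 0` and `ι_w (b x) = G x 1 0 ∕ G x 0 0` near `x₀`:
  `ContinuousAt (fun x => G x 0 0) x₀ ∧ ContinuousAt b x₀`).
* §3 `continuousAt_regRepOne` (`x ↦ !![1, b x * v₀; b x, 1 + b x * u₀]`), `continuousAt_windowMatrix` (`x ↦ !![1, c₁ * b x ^ 2; c₂, 1 + b x * u₀]`, the unit-normalised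
  relative-shell matrix with constant `c₁ c₂`), and **`continuousAt_descentForm_windowMatrix`** (`x ↦ d′ * (s x • (!![1, c₁ * b x ^ 2; c₂, 1 + b x * u₀]).map ι) * d`).

HONEST LABEL: HC_CM is proved only modulo the 2 remaining named inputs (hLiu418, h413) until rung 0 closes; unconditional topology.

## References
* [PlatonovRapinchuk1994] V. Platonov, A. Rapinchuk, *Algebraic Groups and Number Theory* (1994): §3.1 (topology of `G(K_v)`), §5.1 (`F_v ⊂ E_w`).
* [LabesseLanglands1979] J.-P. Labesse, R. P. Langlands, Canad. J. Math. 31 (1979): §2 p. 7 (the matrix of `a + bτ`), p. 9 (window).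
* [Serre1979] J.-P. Serre, *Local Fields*, GTM 67 (1979): Ch. II §1–§2 (complete subfields are closed).
-/

set_option autoImplicit false

noncomputable section

open Set Filter Topology Matrix NumberField IsDedekindDomain

namespace Literature.NumberTheory.Automorphic.UnitaryGroup

open Literature.NumberTheory.Automorphic

/-! ## §1 `ι_w : L⁺_v → L_w` is a closed embedding, so coordinates are continuous iff their images are -/

section Embedding

variable {F : Type} (E : Type) [Field F] [NumberField F] [Field E] [NumberField E] [Algebra F E]
  (v : HeightOneSpectrum (𝓞 F)) (w : PlacesOver E v)
variable {X : Type*} [TopologicalSpace X]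

/-- **`ι_w : F_v → E_w` is a closed embedding** (★ `isClosedEmbedding_adicCompletionOfLiesOver`, read on the tree's `toPlace`). [cite: PlatonovRapinchuk1994, §5.1] [cite: Serre1979, Ch. II §1] -/
theorem isClosedEmbedding_toPlace : IsClosedEmbedding (toPlace (E := E) v w) := by
  haveI := PlacesOver.liesOver w
  exact isClosedEmbedding_adicCompletionOfLiesOver F E v w.1

/-- A coordinate map `b : X → F_v` is continuous at `x₀` iff `ι_w ∘ b` is. [cite: PlatonovRapinchuk1994, §5.1] -/
theorem continuousAt_iff_toPlace_comp {b : X → v.adicCompletion F} {x₀ : X} :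
    ContinuousAt b x₀ ↔ ContinuousAt (fun x => toPlace (E := E) v w (b x)) x₀ :=
  (isClosedEmbedding_toPlace E v w).isEmbedding.isInducing.continuousAt_iff

/-- A coordinate map `b : X → F_v` is continuous iff `ι_w ∘ b` is. [cite: PlatonovRapinchuk1994, §5.1] -/
theorem continuous_iff_toPlace_comp {b : X → v.adicCompletion F} :
    Continuous b ↔ Continuous (fun x => toPlace (E := E) v w (b x)) :=
  (isClosedEmbedding_toPlace E v w).isEmbedding.isInducing.continuous_iff

/-- **A coordinate is continuous at `x₀` as soon as its `ι_w`-image agrees NEAR `x₀` with a function continuous at `x₀`** (the shape in which `b_t` is read off the descent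
matrix: `ι_w (b t) = (G t)₁₀ ∕ (G t)₀₀` wherever `(G t)₀₀ ≠ 0`). [cite: PlatonovRapinchuk1994, §5.1] -/
theorem continuousAt_of_toPlace_comp_eventuallyEq {b : X → v.adicCompletion F} {g : X → w.1.adicCompletion E} {x₀ : X}
    (hg : ContinuousAt g x₀) (hbg : ∀ᶠ x in 𝓝 x₀, toPlace (E := E) v w (b x) = g x) :
    ContinuousAt b x₀ :=
  (continuousAt_iff_toPlace_comp E v w).2 (hg.congr (hbg.mono fun _ h => h.symm))

end Embedding

/-! ## §2 Entries of continuous matrix maps; the descent matrix along the torus; the Eisenstein coordinates -/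

section Coords

variable {X : Type*} [TopologicalSpace X]

/-- Entries of a matrix map continuous at `x₀` are continuous at `x₀`. [cite: PlatonovRapinchuk1994, §3.1] -/
theorem continuousAt_matrix_apply {m n R : Type*} [TopologicalSpace R] {G : X → Matrix m n R} {x₀ : X} (hG : ContinuousAt G x₀) (i : m) (j : n) :
    ContinuousAt (fun x => G x i j) x₀ :=
  continuousAt_pi.1 (continuousAt_pi.1 hG i) j

/-- The RATIO of two entries is continuous at `x₀` off the zeros of the denominator (topological division ring). [cite: PlatonovRapinchuk1994, §3.1] -/
theorem continuousAt_matrix_apply_div {m n K : Type*} [DivisionRing K] [TopologicalSpace K] [IsTopologicalRing K] [ContinuousInv₀ K]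
    {G : X → Matrix m n K} {x₀ : X} (hG : ContinuousAt G x₀) (i j i' j' : _) (h0 : G x₀ i' j' ≠ 0) :
    ContinuousAt (fun x => G x i j / G x i' j') x₀ :=
  (continuousAt_matrix_apply hG i j).div₀ (continuousAt_matrix_apply hG i' j') h0

variable (L : Type) [Field L] [NumberField L] [IsCMField L] (v : HeightOneSpectrum (𝓞 ↥(maximalRealSubfield L)))
  (w : PlacesOver L v) (hw : IsCMField.complexConj L • w.1 = w.1)

include hw in
/-- **The descent matrix is continuous along the torus**: `t ↦ d * ↑(E₂ (↑t).1) * d′` is continuous on `Z(t₀)` for any topological model `E₂` and fixed `d, d′`.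
[cite: PlatonovRapinchuk1994, §3.1, §5.1] -/
theorem continuous_conj_coe_placeModel
    (E₂ : (cmDatum L 2 (Matrix.of fun i j : Fin 2 => if i.val + j.val + 1 = 2 then (1 : L) else 0)).Local v ≃ₜ* ↥(unitaryGroupOfForm (galAdicCompletionMap (L := L) (IsCMField.complexConj L) hw) (placeForm (Matrix.of fun i j : Fin 2 => if i.val + j.val + 1 = 2 then (1 : L) else 0) w.1)))
    (t₀ : ((cmDatum L 2 (Matrix.of fun i j : Fin 2 => if i.val + j.val + 1 = 2 then (1 : L) else 0)).Local v × (cmDatum L 1 (Matrix.of fun i j : Fin 1 => if i.val + j.val + 1 = 1 then (1 : L) else 0)).Local v)) (d d' : Matrix (Fin 2) (Fin 2) (w.1.adicCompletion L)) :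
    Continuous fun t : ↥(Subgroup.centralizer ({t₀} : Set ((cmDatum L 2 (Matrix.of fun i j : Fin 2 => if i.val + j.val + 1 = 2 then (1 : L) else 0)).Local v × (cmDatum L 1 (Matrix.of fun i j : Fin 1 => if i.val + j.val + 1 = 1 then (1 : L) else 0)).Local v))) =>
      d * ((E₂ (t : ((cmDatum L 2 (Matrix.of fun i j : Fin 2 => if i.val + j.val + 1 = 2 then (1 : L) else 0)).Local v × (cmDatum L 1 (Matrix.of fun i j : Fin 1 => if i.val + j.val + 1 = 1 then (1 : L) else 0)).Local v)).1 : GL (Fin 2) (w.1.adicCompletion L)) : Matrix (Fin 2) (Fin 2) (w.1.adicCompletion L)) * d' := by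
  have _ := hw
  have h1 : Continuous fun t : ↥(Subgroup.centralizer ({t₀} : Set ((cmDatum L 2 (Matrix.of fun i j : Fin 2 => if i.val + j.val + 1 = 2 then (1 : L) else 0)).Local v × (cmDatum L 1 (Matrix.of fun i j : Fin 1 => if i.val + j.val + 1 = 1 then (1 : L) else 0)).Local v))) =>
      ((E₂ (t : ((cmDatum L 2 (Matrix.of fun i j : Fin 2 => if i.val + j.val + 1 = 2 then (1 : L) else 0)).Local v × (cmDatum L 1 (Matrix.of fun i j : Fin 1 => if i.val + j.val + 1 = 1 then (1 : L) else 0)).Local v)).1 : GL (Fin 2) (w.1.adicCompletion L)) : Matrix (Fin 2) (Fin 2) (w.1.adicCompletion L)) :=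
    (Units.continuous_val.comp continuous_subtype_val).comp (E₂.continuous.comp (continuous_fst.comp continuous_subtype_val))
  exact (continuous_const.matrix_mul h1).matrix_mul continuous_const

omit [IsCMField L] in
/-- **THE EISENSTEIN COORDINATES ARE CONTINUOUS WHERE `G₀₀ ≠ 0`**: for a matrix map `G : X → M₂(L_w)` continuous at `x₀` with `G x₀ 0 0 ≠ 0` and a coordinate
`b : X → L⁺_v` with `ι_w (b x) = G x 1 0 ∕ G x 0 0` near `x₀` (normalisation `a = 1` of the descent `G = s • ι_w(!![a, b v₀; b, a + b u₀])`): the scalar `x ↦ G x 0 0` and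
the coordinate `b` are continuous at `x₀`. [cite: LabesseLanglands1979, §2 p. 7] [cite: PlatonovRapinchuk1994, §3.1, §5.1] -/
theorem continuousAt_eisensteinCoords {G : X → Matrix (Fin 2) (Fin 2) (w.1.adicCompletion L)} {x₀ : X} (hG : ContinuousAt G x₀) (h0 : G x₀ 0 0 ≠ 0)
    {b : X → v.adicCompletion ↥(maximalRealSubfield L)} (hb : ∀ᶠ x in 𝓝 x₀, toPlace (E := L) v w (b x) = G x 1 0 / G x 0 0) :
    ContinuousAt (fun x => G x 0 0) x₀ ∧ ContinuousAt b x₀ :=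
  ⟨continuousAt_matrix_apply hG 0 0,
    continuousAt_of_toPlace_comp_eventuallyEq L v w (continuousAt_matrix_apply_div hG 1 0 0 0 h0) hb⟩

end Coords

/-! ## §3 The unit-normalised window matrices are continuous in the coordinate -/

section Window

variable {X : Type*} [TopologicalSpace X] {R : Type*} [CommRing R] [TopologicalSpace R] [IsTopologicalRing R]

/-- `x ↦ !![1, b x * v₀; b x, 1 + b x * u₀]` (the normalised regular representation `regRep 1 (b x)`) is continuous at `x₀` when `b` is. [cite: LabesseLanglands1979, §2 p. 7] -/
theorem continuousAt_regRepOne (u₀ v₀ : R) {b : X → R} {x₀ : X} (hb : ContinuousAt b x₀) :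
    ContinuousAt (fun x => !![(1 : R), b x * v₀; b x, 1 + b x * u₀]) x₀ :=
  continuousAt_matrix_two_of_entries continuousAt_const (hb.mul continuousAt_const) hb (continuousAt_const.add (hb.mul continuousAt_const))

/-- **The unit-normalised relative-shell matrix** `x ↦ !![1, c₁ * b x ^ 2; c₂, 1 + b x * u₀]` (`c₂ = r ϖ^i`, `c₁ = v₀ ϖ^(-i) ∕ r` constants) is continuous at `x₀` when `b` is;
at a singular point (`b = 0`) its value is the unipotent `!![1, 0; c₂, 1]`. [cite: LabesseLanglands1979, §2 p. 9] -/
theorem continuousAt_windowMatrix (u₀ c₁ c₂ : R) {b : X → R} {x₀ : X} (hb : ContinuousAt b x₀) :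
    ContinuousAt (fun x => !![(1 : R), c₁ * b x ^ 2; c₂, 1 + b x * u₀]) x₀ :=
  continuousAt_matrix_two_of_entries continuousAt_const (continuousAt_const.mul (hb.pow 2)) continuousAt_const
    (continuousAt_const.add (hb.mul continuousAt_const))

variable {F E : Type*} [CommRing F] [CommRing E] [TopologicalSpace F] [TopologicalSpace E] [IsTopologicalRing F] [IsTopologicalRing E]

/-- **The descent normal form of the window matrix is continuous** at `x₀` when the scalar `s` and the coordinate `b` are:
`x ↦ d′ * (s x • (!![1, c₁ * b x ^ 2; c₂, 1 + b x * u₀]).map ι) * d`. [cite: LabesseLanglands1979, §2 p. 9] [cite: PlatonovRapinchuk1994, §3.1] -/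
theorem continuousAt_descentForm_windowMatrix {ι : F →+* E} (hι : Continuous ι) (d d' : Matrix (Fin 2) (Fin 2) E) (u₀ c₁ c₂ : F)
    {s : X → E} {b : X → F} {x₀ : X} (hs : ContinuousAt s x₀) (hb : ContinuousAt b x₀) :
    ContinuousAt (fun x => d' * (s x • (!![(1 : F), c₁ * b x ^ 2; c₂, 1 + b x * u₀]).map ι) * d) x₀ :=
  continuousAt_descentForm_of_continuousAt hι d d' hs (continuousAt_windowMatrix u₀ c₁ c₂ hb)

/-- The descent normal form of the regular representation `regRep 1 (b x)` is continuous at `x₀` when `s` and `b` are. [cite: LabesseLanglands1979, §2 p. 7] -/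
theorem continuousAt_descentForm_regRepOne {ι : F →+* E} (hι : Continuous ι) (d d' : Matrix (Fin 2) (Fin 2) E) (u₀ v₀ : F)
    {s : X → E} {b : X → F} {x₀ : X} (hs : ContinuousAt s x₀) (hb : ContinuousAt b x₀) :
    ContinuousAt (fun x => d' * (s x • (!![(1 : F), b x * v₀; b x, 1 + b x * u₀]).map ι) * d) x₀ :=
  continuousAt_descentForm_of_continuousAt hι d d' hs (continuousAt_regRepOne u₀ v₀ hb)

end Window

end Literature.NumberTheory.Automorphic.UnitaryGroup

end
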